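import Summits.AtomisticToContinuum.BoseEinsteinCondensation.Theorems.PeriodicIRBound.Negative.GroundOccupation
import Literature.MathematicalPhysics.QuantumManyBody.PeriodicBoseGasMomentumSector
import Literature.MathematicalPhysics.QuantumManyBody.GroundStateDirichletForm
import Literature.MathematicalPhysics.QuantumManyBody.BoseGasDirichletWall

/-!
# Crux `PeriodicIRBound` (stmt-AtomisticToContinuum-3972) — the linear particle–hole floor fails without interaction

Negative-side support file II of the deep-refute pass on the line `linear-ph-floor-wagner`
(`Cruxes/PeriodicIRBound/Lines/linear-ph-floor-wagner.lean`; refuter-drefute-stmt-AtomisticToContinuum-3972-0,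
2026-08-16). The line reads the crux through the Wagner–Feynman bound `n_k Γ_N(k) ≤ ⟨[[a_k,H],a_k†]⟩` and a
LINEAR particle–hole sector floor `C⁺ = LinearParticleHoleFloor : ∀ v adm, ∫v ≠ 0 → LinearFloorFor v`,
`LinearFloorFor v : ∀ C>0 ∃ θ>0 ∃ ρ₀>0 ∀ ρ<ρ₀ ∀ᶠ N ∀ k ≠ 0, ‖k‖² ≤ Cρ →
2E₀^per(N,L_N) + 2θ√ρ‖k‖ ≤ E^per_{N+1}(k;L_N) + E^per_{N-1}(k;L_N)` (bodies restated verbatim below over tree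
primitives; the skeleton's definitions live in a `Cruxes/` work file and are not importable). Companion of
file I `AeZeroPotential.lean` (zero-momentum-gap instances, a.e.-zero profiles are free); independent of it.

Findings (all `[folklore]`, sorry-free, axioms `propext`/`Classical.choice`/`Quot.sound`):

* `integral_conj_planeWaveSum_mul_self`, `lintegral_nnnorm_sq_planeWaveSum` — `‖N_k 1‖² = M (L³)^M` for the
  Bijl–Feynman sum `N_k 1 = ∑ⱼ e^{ik·xⱼ}`, `k = 2πn/L ≠ 0` (cross terms contain `∫_cell e_n = 0`).
* `periodicEnergy_zero_planeWave`, `momentumSectorEnergy_zero_latticeVec_le` — FREE BIJL–FEYNMAN BOUND: at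
  `v = 0` the normalised `N_k 1` has energy exactly `|k|²` (tree: `kineticDensity_planeWaveSum`), hence
  `E^per_M(k;L) ≤ |k|²` on the dual lattice for every `M ≥ 1` (the lower bound `|k|²/M` is
  `ofReal_norm_sq_div_le_momentumSectorEnergy`).
* `not_linearFloorFor_zero` — LOAD-BEARING GUARD OF C⁺: `LinearFloorFor 0` is FALSE (bottom mode
  `k = (2π/L_N)e₀`: `E_{N±1}(k) ≤ 4π²/L_N²` each, while the floor asks `4πθ√ρ/L_N`); the free particle–hole
  gap is `O(|k|/L_N)`, not `θ√ρ|k|`, so any proof of C⁺ must use `∫ v ≠ 0`.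
* Sharpness: by file I (`AeZeroPotential.lean`: a.e.-zero profiles are free at form level,
  `periodicGroundStateEnergy_eq_zero_of_lintegral_eq_zero`, `momentumSectorEnergy_eq_zero_of_lintegral_eq_zero`)
  the floor fails for EVERY a.e.-zero measurable profile, so `∫v ≠ 0` cannot be weakened to `v ≠ 0` (the
  three-line composition with `not_linearFloorFor_zero` is left to the user; this file deliberately does not
  import file I).
-/

noncomputable section

open scoped ENNReal ComplexConjugate
open Filter MeasureTheory

namespace Summit.AtomisticToContinuum.BoseEinsteinCondensation.Theorems.PeriodicIRBound.Negative

open Literature.MathematicalPhysics.QuantumManyBody.BoseGas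
open Summit.AtomisticToContinuum.BoseEinsteinCondensation.Theorems.GaussianDominationCan.Negative
  (integral_cellN_prod integral_cell_const conj_cellWave_mul_self periodicInteraction_zero e0 e0_ne_zero)

/-! ## The free Bijl–Feynman bound and the failure of the linear floor at `v = 0` -/

section BijlFeynman

variable {M : ℕ} {L : ℝ} {n : Fin 3 → ℤ}

/-- `∫_{cell^M} conj(N_k 1) · N_k 1 = M · (L³)^M` for `k = 2πn/L ≠ 0`: the diagonal terms give `(L³)^M`
each, the cross terms contain a factor `∫_cell e_n = 0`. [folklore] -/
theorem integral_conj_planeWaveSum_mul_self (hL : 0 < L) (hn : n ≠ 0) :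
    ∫ X in cellN M L, conj (planeWaveSum L n X) * planeWaveSum L n X =
      (M : ℂ) * ((L : ℂ) ^ 3) ^ M := by
  classical
  -- the all-ones product integral
  have hone : ∫ X in cellN M L, (1 : ℂ) = ((L : ℂ) ^ 3) ^ M := by
    have h := integral_cellN_prod (L := L) (fun (_ : Fin M) (_ : Space) => (1 : ℂ))
    simp only [Finset.prod_const_one] at h
    rw [h]
    simp only [integral_cell_const hL, mul_one, Finset.prod_const, Finset.card_univ,
      Fintype.card_fin]
  -- a cross term vanishes
  have hcross : ∀ j l : Fin M, l ≠ j →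
      ∫ X in cellN M L, conj (cellWave L n (X j)) * cellWave L n (X l) = 0 := by
    intro j l hlj
    set F : Fin M → Space → ℂ := fun i x =>
      if i = j then conj (cellWave L n x) else if i = l then cellWave L n x else 1 with hF
    have hpt : ∀ X : Config M, conj (cellWave L n (X j)) * cellWave L n (X l) = ∏ i, F i (X i) := by
      intro X
      rw [← Finset.mul_prod_erase Finset.univ _ (Finset.mem_univ j),
        ← Finset.mul_prod_erase _ _ (Finset.mem_erase.2 ⟨hlj, Finset.mem_univ l⟩)]
      have h1 : F j (X j) = conj (cellWave L n (X j)) := by simp [hF]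
      have h2 : F l (X l) = cellWave L n (X l) := by simp [hF, hlj]
      have h3 : ∏ i ∈ (Finset.univ.erase j).erase l, F i (X i) = 1 := by
        refine Finset.prod_eq_one fun i hi => ?_
        have hil : i ≠ l := Finset.ne_of_mem_erase hi
        have hij : i ≠ j := Finset.ne_of_mem_erase (Finset.mem_of_mem_erase hi)
        simp [hF, hil, hij]
      rw [h1, h2, h3, mul_one]
    simp_rw [hpt]
    rw [integral_cellN_prod]
    refine Finset.prod_eq_zero (Finset.mem_univ l) ?_
    have : F l = cellWave L n := by
      funext x
      simp [hF, hlj]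
    rw [this]
    exact integral_cell_cellWave_eq_zero hL hn
  -- expand
  have hexp : ∀ X : Config M, conj (planeWaveSum L n X) * planeWaveSum L n X =
      ∑ j, ∑ l, conj (cellWave L n (X j)) * cellWave L n (X l) := by
    intro X
    unfold planeWaveSum
    rw [map_sum, Finset.sum_mul]
    exact Finset.sum_congr rfl fun j _ => Finset.mul_sum _ _ _
  simp_rw [hexp]
  have hint : ∀ j l : Fin M, Integrable (fun X : Config M => conj (cellWave L n (X j)) * cellWave L n (X l))
      (volume.restrict (cellN M L)) := fun j l =>
    integrableOn_cellN (by fun_prop) L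
  rw [integral_finsetSum _ (fun j _ => integrable_finsetSum _ (fun l _ => hint j l))]
  have hj : ∀ j : Fin M, ∫ X in cellN M L, ∑ l, conj (cellWave L n (X j)) * cellWave L n (X l) =
      ((L : ℂ) ^ 3) ^ M := by
    intro j
    rw [integral_finsetSum _ (fun l _ => hint j l), Finset.sum_eq_single j
      (fun l _ hlj => hcross j l hlj) (fun h => (h (Finset.mem_univ j)).elim)]
    simp_rw [conj_cellWave_mul_self]
    exact hone
  simp only [hj, Finset.sum_const, Finset.card_univ, Fintype.card_fin, nsmul_eq_mul]

/-- `∫⁻_{cell^M} ‖N_k 1‖₊² = M (L³)^M` (`ℝ≥0∞` form). [folklore] -/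
theorem lintegral_nnnorm_sq_planeWaveSum (hL : 0 < L) (hn : n ≠ 0) :
    ∫⁻ X in cellN M L, ((‖planeWaveSum L n X‖₊ : ℝ≥0∞)) ^ 2 = ENNReal.ofReal (M * (L ^ 3) ^ M) := by
  have hcont : Continuous (planeWaveSum (M := M) L n) := (contDiff_planeWaveSum L n).continuous
  have hc2 : Continuous fun X : Config M => ‖planeWaveSum L n X‖ ^ 2 := hcont.norm.pow 2
  simp_rw [coe_nnnorm_sq_eq_ofReal]
  rw [← ofReal_integral_eq_lintegral_ofReal (integrableOn_cellN hc2 L)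
    (Eventually.of_forall fun X => by positivity)]
  congr 1
  have h := integral_conj_planeWaveSum_mul_self (M := M) hL hn
  simp_rw [Complex.conj_mul', ← Complex.ofReal_pow] at h
  rw [integral_complex_ofReal] at h
  exact_mod_cast h


/-- **Free energy of the normalised Bijl–Feynman state**: `⟨N_k1, -Δ N_k1⟩/‖N_k1‖² = |k|²`,
`k = 2πn/L`, for `v = 0`, `M ≥ 1` particles, `n ≠ 0` (with the tree's `kineticDensity_planeWaveSum`:
`|∇N_k1|² = M|k|²` pointwise). [folklore] -/
theorem periodicEnergy_zero_planeWave (hL : 0 < L) (hM : 0 < M) (hn : n ≠ 0) :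
    periodicEnergy 0 (PeriodicTrialState.planeWave hL hM n) =
      (‖latticeVec (2 * Real.pi / L) n‖₊ : ℝ≥0∞) ^ 2 := by
  set K : ℝ≥0∞ := (‖latticeVec (2 * Real.pi / L) n‖₊ : ℝ≥0∞) ^ 2 with hKdef
  set I : ℝ≥0∞ := ∫⁻ X in cellN M L, ((‖planeWaveSum L n X‖₊ : ℝ≥0∞)) ^ 2 with hI
  have hIval : I = ENNReal.ofReal (M * (L ^ 3) ^ M) := lintegral_nnnorm_sq_planeWaveSum hL hn
  have hIpos : (0 : ℝ) < M * (L ^ 3) ^ M := by positivity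
  have hItoReal : I.toReal = M * (L ^ 3) ^ M := by rw [hIval, ENNReal.toReal_ofReal hIpos.le]
  set c : ℂ := ((Real.sqrt I.toReal)⁻¹ : ℂ) with hc
  have hψ : (PeriodicTrialState.planeWave hL hM n).ψ = fun X => c * planeWaveSum L n X := rfl
  -- kinetic density of the normalised state (constant in `X`)
  have hkin : ∀ X : Config M, kineticDensity (fun X => c * planeWaveSum L n X) X =
      ENNReal.ofReal ((M * (L ^ 3) ^ M)⁻¹) * ((M : ℝ≥0∞) * K) := by
    intro X
    have hdiff : ∀ Y, DifferentiableAt ℝ (planeWaveSum (M := M) L n) Y :=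
      fun Y => ((contDiff_planeWaveSum L n).differentiable one_ne_zero) Y
    have h1 : kineticDensity (fun X => c * planeWaveSum L n X) X =
        ((‖c‖₊ : ℝ≥0∞)) ^ 2 * kineticDensity (planeWaveSum (M := M) L n) X := by
      unfold kineticDensity
      rw [Finset.mul_sum]
      refine Finset.sum_congr rfl fun i _ => ?_
      rw [Finset.mul_sum]
      refine Finset.sum_congr rfl fun a _ => ?_
      rw [fderiv_const_mul (hdiff X), FunLike.coe_smul, Pi.smul_apply, smul_eq_mul,
        nnnorm_mul, ENNReal.coe_mul, mul_pow]
    rw [h1, kineticDensity_planeWaveSum, coe_nnnorm_sq_eq_ofReal]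
    congr 2
    rw [hc, norm_inv, Complex.norm_real, Real.norm_of_nonneg (Real.sqrt_nonneg _), inv_pow,
      Real.sq_sqrt ENNReal.toReal_nonneg, hItoReal]
  unfold periodicEnergy
  simp only [periodicInteraction_zero, zero_mul, add_zero]
  rw [hψ]
  simp_rw [hkin]
  rw [setLIntegral_const, volume_cellN, ← ENNReal.ofReal_pow hL.le, ← ENNReal.ofReal_pow (by positivity),
    ← ENNReal.ofReal_natCast M]
  calc ENNReal.ofReal ((M * (L ^ 3) ^ M)⁻¹) * (ENNReal.ofReal M * K) * ENNReal.ofReal ((L ^ 3) ^ M)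
      = ENNReal.ofReal ((M * (L ^ 3) ^ M)⁻¹) * ENNReal.ofReal M * ENNReal.ofReal ((L ^ 3) ^ M) * K := by
        ring
    _ = K := by
        rw [← ENNReal.ofReal_mul (by positivity), ← ENNReal.ofReal_mul (by positivity),
          show (M * (L ^ 3) ^ M : ℝ)⁻¹ * M * (L ^ 3) ^ M = 1 by field_simp, ENNReal.ofReal_one, one_mul]

/-- **Free Bijl–Feynman bound**: at `v = 0`, `E^per_M(k; L) ≤ |k|²` for every dual-lattice momentum
`k = 2πn/L`, `n ≠ 0`, `M ≥ 1`, `L > 0`. (The lower bound `|k|²/M` is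
`ofReal_norm_sq_div_le_momentumSectorEnergy`.) [folklore] -/
theorem momentumSectorEnergy_zero_latticeVec_le (hL : 0 < L) (hM : 0 < M) (hn : n ≠ 0) :
    momentumSectorEnergy 0 M L (latticeVec (2 * Real.pi / L) n) ≤
      (‖latticeVec (2 * Real.pi / L) n‖₊ : ℝ≥0∞) ^ 2 :=
  (momentumSectorEnergy_latticeVec_le_planeWave 0 hL hM n).trans
    (periodicEnergy_zero_planeWave hL hM hn).le

/-- The bottom lattice mode `(2π/L) e₀` is the coordinate vector `(2π/L, 0, 0)`. [folklore] -/
theorem latticeVec_e0 (c : ℝ) : latticeVec c e0 = EuclideanSpace.single 0 c := by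
  ext a
  simp only [latticeVec, PiLp.toLp_apply, PiLp.single_apply]
  by_cases ha : a = 0
  · subst ha
    simp [GaussianDominationCan.Negative.e0]
  · rw [if_neg ha]
    simp [GaussianDominationCan.Negative.e0, Pi.single_eq_of_ne ha]

/-- **The linear particle–hole floor FAILS for the free gas** (`¬ LinearFloorFor 0` of the skeleton
`Lines/linear-ph-floor-wagner.lean`, body verbatim at `v = 0`): at the bottom mode `k = (2π/L_N)e₀` the
free sector energies are `≤ |k|² = 4π²/L_N²` (Bijl–Feynman bound) while the floor asks for
`2θ√ρ|k| = 4πθ√ρ/L_N ≫ 8π²/L_N²`. So the guard `∫ v ≠ 0` in `LinearParticleHoleFloor` (C⁺) is load-bearing: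
any proof of C⁺ must use the interaction (`Γ_free(k) = O(|k|/L_N)`, not `θ√ρ|k|`). [folklore] -/
theorem not_linearFloorFor_zero :
    ¬ ∀ C : ℝ, 0 < C → ∃ θ : ℝ, 0 < θ ∧ ∃ ρ₀ : ℝ, 0 < ρ₀ ∧ ∀ ρ : ℝ, 0 < ρ → ρ < ρ₀ →
      ∀ᶠ N : ℕ in atTop, ∀ k : Space, k ≠ 0 → ‖k‖ ^ 2 ≤ C * ρ →
        2 * periodicGroundStateEnergy (0 : ℝ → ℝ≥0∞) N (sideLength ρ N) +
            ENNReal.ofReal (2 * θ * Real.sqrt ρ * ‖k‖) ≤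
          momentumSectorEnergy 0 (N + 1) (sideLength ρ N) k +
            momentumSectorEnergy 0 (N - 1) (sideLength ρ N) k := by
  intro h
  obtain ⟨θ, hθ, ρ₀, hρ₀, h⟩ := h 1 one_pos
  have hρ : (0 : ℝ) < ρ₀ / 2 := by positivity
  have hρρ₀ : ρ₀ / 2 < ρ₀ := by linarith
  set ρ : ℝ := ρ₀ / 2 with hρdef
  have hsρ : 0 < Real.sqrt ρ := Real.sqrt_pos.2 hρ
  have ev := h ρ hρ hρρ₀
  have ev1 : ∀ᶠ N : ℕ in atTop, 2 ≤ N := eventually_ge_atTop 2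
  have ev2 : ∀ᶠ N : ℕ in atTop, 2 * Real.pi / Real.sqrt ρ ≤ sideLength ρ N :=
    (tendsto_sideLength_atTop hρ).eventually_ge_atTop _
  have ev3 : ∀ᶠ N : ℕ in atTop, 2 * Real.pi / (θ * Real.sqrt ρ) < sideLength ρ N :=
    (tendsto_sideLength_atTop hρ).eventually_gt_atTop _
  obtain ⟨N, hN, hN2, hL1, hL2⟩ := (ev.and (ev1.and (ev2.and ev3))).exists
  set L := sideLength ρ N with hLdef
  have hL : 0 < L := sideLength_pos_of_pos hρ (by omega)
  -- the bottom lattice mode `k = (2π/L) e₀`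
  set k : Space := latticeVec (2 * Real.pi / L) e0 with hkdef
  have hknorm : ‖k‖ = 2 * Real.pi / L := by
    rw [hkdef, latticeVec_e0, PiLp.norm_single, Real.norm_of_nonneg (by positivity)]
  have hk0 : k ≠ 0 := by
    rw [← norm_ne_zero_iff, hknorm]
    positivity
  have hkC : ‖k‖ ^ 2 ≤ 1 * ρ := by
    rw [hknorm, one_mul]
    have h1 : 2 * Real.pi / L ≤ Real.sqrt ρ := by
      rw [div_le_iff₀ hL]
      rw [div_le_iff₀ hsρ] at hL1
      linarith [mul_comm (Real.sqrt ρ) L]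
    calc (2 * Real.pi / L) ^ 2 ≤ Real.sqrt ρ ^ 2 := pow_le_pow_left₀ (by positivity) h1 2
      _ = ρ := Real.sq_sqrt hρ.le
  have key := hN k hk0 hkC
  rw [periodicGroundStateEnergy_zero_eq_zero N hL, mul_zero, zero_add] at key
  -- free Bijl–Feynman upper bounds on the two sector energies
  have hub : ∀ {M : ℕ}, 0 < M →
      momentumSectorEnergy 0 M L k ≤ ENNReal.ofReal ((2 * Real.pi / L) ^ 2) := by
    intro M hM
    have h' := momentumSectorEnergy_zero_latticeVec_le (n := e0) hL hM e0_ne_zero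
    rwa [← hkdef, coe_nnnorm_sq_eq_ofReal, hknorm] at h'
  have h2 := key.trans (add_le_add (hub (by omega : 0 < N + 1)) (hub (by omega : 0 < N - 1)))
  rw [← ENNReal.ofReal_add (by positivity) (by positivity), hknorm,
    ENNReal.ofReal_le_ofReal_iff (by positivity)] at h2
  -- `h2 : 2θ√ρ (2π/L) ≤ 2(2π/L)²`, i.e. `θ√ρ L ≤ 2π`, against `L > 2π/(θ√ρ)`
  have h3 : 2 * Real.pi < θ * Real.sqrt ρ * L := by
    have h' := hL2
    rw [div_lt_iff₀ (by positivity)] at h'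
    linarith [mul_comm L (θ * Real.sqrt ρ)]
  have h4 : (4 * Real.pi / L) * (θ * Real.sqrt ρ) ≤ (4 * Real.pi / L) * (2 * Real.pi / L) := by
    have e1 : 2 * θ * Real.sqrt ρ * (2 * Real.pi / L) = (4 * Real.pi / L) * (θ * Real.sqrt ρ) := by ring
    have e2 : (2 * Real.pi / L) ^ 2 + (2 * Real.pi / L) ^ 2 = (4 * Real.pi / L) * (2 * Real.pi / L) := by
      ring
    rw [e1, e2] at h2
    exact h2
  have h5 : θ * Real.sqrt ρ ≤ 2 * Real.pi / L := le_of_mul_le_mul_left h4 (by positivity)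
  rw [le_div_iff₀ hL] at h5
  linarith

end BijlFeynman

end Summit.AtomisticToContinuum.BoseEinsteinCondensation.Theorems.PeriodicIRBound.Negative

end
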